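import Mathlib
import Literature.Probability.LatticeModels.DiscreteGreenKernelConvergence
import Literature.Probability.LatticeModels.GreenFunctionConformalRadiusProofs
import Literature.Probability.LatticeModels.FlatBoundaryPoissonKernelLimitProofs
import Literature.Probability.LatticeModels.LatticeHarmonicCompactness
import Literature.Probability.LatticeModels.DiscreteHarmonicLimit
import Literature.Probability.LatticeModels.LatticeHarmonicMeasure
import Literature.Probability.LatticeModels.LatticeWalkCrossing
import Literature.Analysis.Complex.HarmonicMaxPrinciple
import HarnessLib

/-!
# Proof of Chelkak–Wan 2021, Corollary 3.3: convergence of the killed Green's function under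
# Carathéodory approximation (`killedGreen_tendsto_of_kernelConvergence_holds`)

Topic `Literature/Probability/LatticeModels`; sibling of `DiscreteGreenKernelConvergence.lean`,
which STATES Chelkak–Wan 2021, Cor. 3.3 (= Chelkak–Smirnov 2011, Thm. 3.9 with Thm. 2.5, on `ℤ²`)
as the named fact `killedGreen_tendsto_of_kernelConvergence`. This file DISCHARGES it:
`killedGreen_tendsto_of_kernelConvergence_holds`. Everything here is proved; no definition, no
named fact.

D. Chelkak, Y. Wan, Electron. J. Probab. 26 (2021), paper 54, §3.1, Cor. 3.3: "Let `Ω ⊂ B(0,R)`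
be a simply connected planar domain and `u, v ∈ Ω` be two distinct points of `Ω`. Assume that
discrete domains `Ω̂^δ ⊂ B(0,R)` approximate `Ω` (in the Carathéodory topology with respect to `u`
or `v`) as `δ → 0`. Then `Z_{Ω^δ}(u^δ, v^δ) → G_Ω(u, v)` as `δ → 0`." The printed proof ("this
follows from [CS11] and the convergence of the discrete full-plane Green function") is the road of
D. Chelkak, S. Smirnov, Adv. Math. 228 (2011), §3.2–§3.3 (Thm. 3.8, Thm. 3.10): uniform
estimates, compactness of discrete harmonic functions, identification of subsequential limits by
their boundary values. We follow it, with one simplification available on `ℤ²`: instead of the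
Green's function `G_A(c, ·)` itself (singular at the pole) we run the argument on its
normalisation by the planar potential kernel (Kenyon 2000, proof of Thm. 13; the device of
`FlatBoundaryPoissonKernelLimitProofs.lean`),
`F = G_A(c, ·) + a(· − c)/2 − L`, `L = −(2π)⁻¹ log δ + κ/2`, `a = latticePotentialKernel 2`
(`Δ a = 2δ₀`, `a(x) = (1/π) log |x| + κ + o(1)`, `latticePotentialKernel_two_asymptotics` — this is
the "convergence of the discrete full-plane Green function" of [CW21] Prop. 3.2), which is lattice
harmonic on ALL of `A` with outer boundary values `(2π)⁻¹ log ‖δw − v‖ + o(1)`.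

## Architecture (sections A–H)

* A, B — the polygonal representation `δ • starDomain A` read on the lattice (`δy ∈ δ • starDomain A
  ↔ y ∈ A`), and the two clauses of kernel convergence along a sequence of meshes: compact subsets
  of `Ω` are eventually filled by vertices (`eventually_forall_mem_of_meshPoint_mem`); near every
  frontier point of `Ω` there is eventually a lattice site OUTSIDE the domain
  (`eventually_exists_not_mem_near`).
* C — boundary data (`greenNormalised_data_of_far`) and a global sup bound (`abs_greenNormalised_le`,
  discrete maximum principle) for the normalised Green's function.
* D — compactness: `exists_subseq_tendstoUniformlyOn_of_eventually_latticeHarmonic`, the theorem of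
  `LatticeHarmonicCompactness.lean` with harmonicity required only eventually on compacts (the
  discrete domains exhaust `Ω` only in the limit).
* E — boundary values at the lattice scale: `eventually_abs_sub_le_near_of_holeFree`, the
  two-constant bound on `A ∩ (box)` with the far boundary weighted by the weak Beurling estimate
  (`le_add_rpow_of_cutPath`, Smirnov 2010 Lemma B.2/B.3), the cut being the hole-free escape path
  of the exterior site supplied by kernel convergence.
* G — identification: subsequential limits are harmonic (`harmonicOnNhd_of_latticeHarmonic_limit`),
  have boundary values `(2π)⁻¹ log ‖· − v‖` at every frontier point, and so coincide with the Green
  potential `(2π)⁻¹ log ‖(φ⁻¹· − conj φ⁻¹v)/dslope φ⁻¹ v ·‖` of `GreenPotentialBoundary.lean`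
  (`harmonicOnNhd_greenPotential`, `tendsto_green_nhdsWithin_frontier`) by the maximum principle
  (`eqOn_of_harmonic_of_boundary`); `exists_subseq_tendsto_greenNormalised` is the resulting
  statement along a sequence of meshes.
* H — the theorem: the sub-subsequence principle along `𝓝[>] 0` (`tendsto_of_subseq_tendsto`),
  `a(u_δ − v_δ)/2 − L_δ → (2π)⁻¹ log ‖u − v‖` (`tendsto_potentialNormalised`) and
  `Z = SRW.killedGreen (siteGraph A) = 4 · dirichletGreen A`
  (`KozdronLawler.killedGreen_siteGraph_eq_four_mul_dirichletGreen`), giving the limit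
  `(2/π) log(‖φ⁻¹u − conj φ⁻¹v‖/‖φ⁻¹u − φ⁻¹v‖)`.

Only the HoleFree clause of `ChelkakSmirnov.IsDiscreteDomain` is used (connectedness of the
discrete domain is not needed for the pointwise statement). Deliberately NOT here: the uniform
clause of Cor. 3.3 / Prop. 3.2 ("jointly `r`-inside"), isoradial graphs, the massive case.

## References

* D. Chelkak, Y. Wan, Electron. J. Probab. 26 (2021), paper no. 54, §3.1, Prop. 3.2, Cor. 3.3
  [ChelkakWan2021].
* D. Chelkak, S. Smirnov, Adv. Math. 228 (2011) 1590–1630, §3.2–§3.3, Thm. 3.8, Thm. 3.10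
  [ChelkakSmirnov2011].
* S. Smirnov, Ann. of Math. 172 (2010), App. B, Lemmas B.2–B.3 [Smirnov2010].
* R. Kenyon, Ann. Probab. 28 (2000), proof of Thm. 13 [Kenyon2000].
* G. F. Lawler, V. Limic, *Random Walk: A Modern Introduction* (2010), Thm. 4.4.4, §6.2
  [LawlerLimic2010].
-/

noncomputable section

open Set Metric Filter Complex
open scoped Topology Real Pointwise
open Literature.Probability.RandomPlanarGeometry (ChordalLERW.siteGraph ConformalEquiv)

namespace Literature.Probability.LatticeModels

/-! ### A. The polygonal representation `δ • starDomain A` read on the lattice -/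

/-- Points of the mesh-`δ` polygonal domain `δ • starDomain A`, in lattice units: `w` lies in it iff
`w/δ` lies in the open unit-coordinate square about a site of `A`. [folklore] -/
theorem mem_smul_starDomain_iff_div {δ : ℝ} (hδ : 0 < δ) {A : Set (Site 2)} {w : ℂ} :
    w ∈ δ • ChelkakSmirnov.starDomain A ↔
      ∃ x ∈ A, |w.re / δ - ((x 0 : ℤ) : ℝ)| < 1 ∧ |w.im / δ - ((x 1 : ℤ) : ℝ)| < 1 := by
  rw [Set.mem_smul_set_iff_inv_smul_mem₀ hδ.ne', ChelkakSmirnov.starDomain, Set.mem_iUnion₂]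
  simp only [Set.mem_setOf_eq, Complex.smul_re, Complex.smul_im, smul_eq_mul, exists_prop,
    inv_mul_eq_div]

/-- **A lattice point lies in the polygonal representation iff it is a vertex of the domain**:
`δ y ∈ δ • starDomain A ↔ y ∈ A`. [folklore] -/
theorem meshPoint_mem_smul_starDomain_iff {δ : ℝ} (hδ : 0 < δ) {A : Set (Site 2)} {y : Site 2} :
    meshPoint δ y ∈ δ • ChelkakSmirnov.starDomain A ↔ y ∈ A := by
  rw [mem_smul_starDomain_iff_div hδ, meshPoint_re, meshPoint_im, mul_div_cancel_left₀ _ hδ.ne',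
    mul_div_cancel_left₀ _ hδ.ne']
  constructor
  · rintro ⟨x, hx, h0, h1⟩
    have e0 : y 0 = x 0 := by
      have : |((y 0 - x 0 : ℤ) : ℝ)| < 1 := by push_cast; exact h0
      have : |y 0 - x 0| < 1 := by exact_mod_cast this
      rw [abs_lt] at this; omega
    have e1 : y 1 = x 1 := by
      have : |((y 1 - x 1 : ℤ) : ℝ)| < 1 := by push_cast; exact h1
      have : |y 1 - x 1| < 1 := by exact_mod_cast this
      rw [abs_lt] at this; omega
    have : y = x := by ext i; fin_cases i <;> assumption
    rw [this]; exact hx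
  · intro hy
    exact ⟨y, hy, by simp, by simp⟩

/-- A point outside the polygonal representation rounds to a site outside the domain (rounding
moves each coordinate of `w/δ` by at most `1/2`). [folklore] -/
theorem nearestSite_not_mem_of_not_mem_smul_starDomain {δ : ℝ} (hδ : 0 < δ) {A : Set (Site 2)}
    {w : ℂ} (hw : w ∉ δ • ChelkakSmirnov.starDomain A) : nearestSite δ w ∉ A := by
  intro hmem
  apply hw
  rw [mem_smul_starDomain_iff_div hδ]
  refine ⟨_, hmem, ?_, ?_⟩
  · show |w.re / δ - ((round (w.re / δ) : ℤ) : ℝ)| < 1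
    have := abs_sub_round (w.re / δ)
    linarith
  · show |w.im / δ - ((round (w.im / δ) : ℤ) : ℝ)| < 1
    have := abs_sub_round (w.im / δ)
    linarith

/-- The polygonal representation is open. [folklore] -/
theorem isOpen_smul_starDomain {δ : ℝ} (hδ : 0 < δ) (A : Set (Site 2)) :
    IsOpen (δ • ChelkakSmirnov.starDomain A) := by
  refine IsOpen.smul₀ ?_ hδ.ne'
  refine isOpen_iUnion fun x => isOpen_iUnion fun _ => ?_
  exact (isOpen_lt (continuous_abs.comp (Complex.continuous_re.sub continuous_const)) continuous_const).inter
    (isOpen_lt (continuous_abs.comp (Complex.continuous_im.sub continuous_const)) continuous_const)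

/-! ### B. Kernel convergence along a sequence of meshes, read on the lattice -/

section KernelSeq

variable {Ω : Set ℂ} {δ : ℕ → ℝ} {A : ℕ → Finset (Site 2)}

/-- **Interior points, compact form.** If every point of `Ω` has a ball eventually inside the
polygonal domains, then for every compact `K ⊆ Ω`, eventually every site with mesh point in `K`
is a vertex of the discrete domain. [folklore] -/
theorem eventually_forall_mem_of_meshPoint_mem (hδ : ∀ n, 0 < δ n)
    (hin : ∀ z ∈ Ω, ∃ ρ : ℝ, 0 < ρ ∧ ∀ᶠ n in atTop,
      ball z ρ ⊆ δ n • ChelkakSmirnov.starDomain (↑(A n) : Set (Site 2)))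
    {K : Set ℂ} (hKΩ : K ⊆ Ω) (hK : IsCompact K) :
    ∀ᶠ n in atTop, ∀ y : Site 2, meshPoint (δ n) y ∈ K → y ∈ A n := by
  choose! ρ hρ hev using hin
  obtain ⟨t, htK, hcover⟩ := hK.elim_nhds_subcover (fun z => ball z (ρ z))
    (fun z hz => ball_mem_nhds z (hρ z (hKΩ hz)))
  have hall : ∀ᶠ n in atTop, ∀ z ∈ t,
      ball (z : ℂ) (ρ z) ⊆ δ n • ChelkakSmirnov.starDomain (↑(A n) : Set (Site 2)) :=
    (t.eventually_all).2 fun z hz => hev z (hKΩ (htK z hz))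
  filter_upwards [hall] with n hn y hy
  obtain ⟨z, hzt, hyz⟩ := Set.mem_iUnion₂.1 (hcover hy)
  exact (meshPoint_mem_smul_starDomain_iff (hδ n)).1 (hn z hzt hyz)

/-- **Boundary points.** If the frontiers of the polygonal domains come close to every frontier
point of `Ω` and `δ n → 0`, then near every frontier point of `Ω` there is eventually a lattice
site OUTSIDE the discrete domain. [folklore] -/
theorem eventually_exists_not_mem_near (hδ : ∀ n, 0 < δ n) (hδ0 : Tendsto δ atTop (𝓝 0))
    (hbd : ∀ a ∈ frontier Ω, ∀ ρ : ℝ, 0 < ρ → ∀ᶠ n in atTop,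
      (frontier (δ n • ChelkakSmirnov.starDomain (↑(A n) : Set (Site 2))) ∩ ball a ρ).Nonempty)
    {a : ℂ} (ha : a ∈ frontier Ω) {ρ : ℝ} (hρ : 0 < ρ) :
    ∀ᶠ n in atTop, ∃ p : Site 2, p ∉ A n ∧ dist (meshPoint (δ n) p) a < ρ := by
  filter_upwards [hbd a ha (ρ / 2) (half_pos hρ), hδ0.eventually (Iio_mem_nhds (half_pos hρ))]
    with n hn hδn
  obtain ⟨w, hwfr, hwa⟩ := hn
  have hwout : w ∉ δ n • ChelkakSmirnov.starDomain (↑(A n) : Set (Site 2)) := by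
    have := (isOpen_smul_starDomain (hδ n) (↑(A n) : Set (Site 2))).inter_frontier_eq
    intro h
    have : w ∈ (δ n • ChelkakSmirnov.starDomain (↑(A n) : Set (Site 2))) ∩
        frontier (δ n • ChelkakSmirnov.starDomain (↑(A n) : Set (Site 2))) := ⟨h, hwfr⟩
    rw [(isOpen_smul_starDomain (hδ n) _).inter_frontier_eq] at this
    exact this
  refine ⟨nearestSite (δ n) w, ?_, ?_⟩
  · exact fun h => nearestSite_not_mem_of_not_mem_smul_starDomain (hδ n) hwout (Finset.mem_coe.2 h)
  · have h1 := dist_meshPoint_nearestSite_le (hδ n) w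
    have h2 : dist w a < ρ / 2 := mem_ball.1 hwa
    have h3 : δ n < ρ / 2 := hδn
    calc dist (meshPoint (δ n) (nearestSite (δ n) w)) a
        ≤ dist (meshPoint (δ n) (nearestSite (δ n) w)) w + dist w a := dist_triangle _ _ _
      _ < ρ := by linarith

end KernelSeq


/-! ### C. The normalised Green function `G_A(c, ·) + a(· - c)/2 - L`: boundary data and a global bound -/

section Normalised

variable {δ : ℕ → ℝ} {V : ℕ → Finset (Site 2)} {c : ℕ → Site 2} {u : ℂ} {κ : ℝ}

/-- **Boundary data of the normalised Green function** (variant of `greenNormalised_data` in which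
the discretisation is only assumed to keep the sites OUTSIDE the domain at distance `≥ r_u` from
the pole `u`, eventually): with `Lₙ = -(2π)⁻¹ log δₙ + κ/2`, eventually, uniformly on the outer
boundary of `Vₙ`, `G_{Vₙ}(cₙ, w) + a(w - cₙ)/2 - Lₙ = (2π)⁻¹ log ‖δₙ w - u‖ + O(ε)`.
[cite: Kenyon2000, §5.2] -/
theorem greenNormalised_data_of_far {r_u : ℝ} (hru : 0 < r_u)
    (hδ : ∀ n, 0 < δ n) (hδ0 : Tendsto δ atTop (𝓝 0))
    (hfar : ∀ᶠ n in atTop, ∀ w : Site 2, w ∉ V n → r_u ≤ dist (meshPoint (δ n) w) u)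
    (hcu : Tendsto (fun n => meshPoint (δ n) (c n)) atTop (𝓝 u))
    (hA : Tendsto (fun y : Site 2 => latticePotentialKernel 2 y -
      (2 * π)⁻¹ * Real.log (((y 0 : ℤ) : ℝ) ^ 2 + ((y 1 : ℤ) : ℝ) ^ 2)) cofinite (𝓝 κ))
    {ε : ℝ} (hε : 0 < ε) :
    ∀ᶠ n in atTop, ∀ w ∈ latticeOuterBoundary (↑(V n) : Set (Site 2)),
      |(dirichletGreen (V n) (c n) w + latticePotentialKernel 2 (w - c n) / 2 -
          (-(2 * π)⁻¹ * Real.log (δ n) + κ / 2)) -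
        (2 * π)⁻¹ * Real.log ‖meshPoint (δ n) w - u‖| ≤ ε := by
  obtain ⟨N, hN0, hN⟩ := exists_forall_max_le_abs_sub_le hA hε
  have hε' : 0 < π * ε * r_u / 2 := by positivity
  filter_upwards [hcu.eventually (ball_mem_nhds u (show (0 : ℝ) < min (r_u / 2) (π * ε * r_u / 2)
      by positivity)), hδ0.eventually (Iio_mem_nhds (show (0 : ℝ) < r_u / 2 / (2 * N) by positivity)),
      hfar] with n hcn hδn hfarn
  have hd0 : 0 < δ n := hδ n
  have hcn' : dist (meshPoint (δ n) (c n)) u < min (r_u / 2) (π * ε * r_u / 2) := mem_ball.1 hcn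
  have hcn1 : dist (meshPoint (δ n) (c n)) u < r_u / 2 := lt_of_lt_of_le hcn' (min_le_left _ _)
  have hcn2 : dist (meshPoint (δ n) (c n)) u < π * ε * r_u / 2 := lt_of_lt_of_le hcn' (min_le_right _ _)
  have hδn' : δ n < r_u / 2 / (2 * N) := hδn
  intro w hw
  have hwV : w ∉ V n := fun h => hw.1 (Finset.mem_coe.2 h)
  have hwu : r_u ≤ dist (meshPoint (δ n) w) u := hfarn w hwV
  have hwc : r_u / 2 ≤ dist (meshPoint (δ n) w) (meshPoint (δ n) (c n)) := by
    linarith [dist_triangle (meshPoint (δ n) w) (meshPoint (δ n) (c n)) u]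
  have hwc0 : w ≠ c n := by
    intro h; rw [h, dist_self] at hwc; linarith
  rw [dirichletGreen_of_not_mem_right (V n) (c n) hwV, zero_add]
  have key := potentialNormalised_eq hd0 hwc0 κ
  have hrw : latticePotentialKernel 2 (w - c n) / 2 - (-(2 * π)⁻¹ * Real.log (δ n) + κ / 2) =
      latticePotentialKernel 2 (w - c n) / 2 + (2 * π)⁻¹ * Real.log (δ n) - κ / 2 := by ring
  rw [hrw, key]
  have hAκ : |latticePotentialKernel 2 (w - c n) -
      (2 * π)⁻¹ * Real.log ((((w - c n) 0 : ℤ) : ℝ) ^ 2 + (((w - c n) 1 : ℤ) : ℝ) ^ 2) - κ| ≤ ε :=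
    hN _ (le_max_of_dist_meshPoint_ge hd0 hN0 hwc hδn'.le)
  have hlog : |Real.log (dist (meshPoint (δ n) w) (meshPoint (δ n) (c n))) -
      Real.log ‖meshPoint (δ n) w - u‖| ≤ dist (meshPoint (δ n) (c n)) u / (r_u / 2) := by
    refine (abs_log_sub_log_le' (by positivity) hwc ?_).trans ?_
    · rw [← dist_eq_norm]; linarith
    · refine div_le_div_of_nonneg_right ?_ (by positivity)
      rw [dist_eq_norm, dist_eq_norm]
      have := abs_norm_sub_norm_le (meshPoint (δ n) w - meshPoint (δ n) (c n)) (meshPoint (δ n) w - u)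
      rwa [sub_sub_sub_cancel_left, norm_sub_rev u] at this
  have hlog' : (2 * π)⁻¹ * (dist (meshPoint (δ n) (c n)) u / (r_u / 2)) ≤ ε / 2 := by
    rw [div_div_eq_mul_div]
    have h1 : dist (meshPoint (δ n) (c n)) u * 2 / r_u ≤ π * ε := by
      rw [div_le_iff₀ hru]; linarith
    calc (2 * π)⁻¹ * (dist (meshPoint (δ n) (c n)) u * 2 / r_u) ≤ (2 * π)⁻¹ * (π * ε) :=
          mul_le_mul_of_nonneg_left h1 (by positivity)
      _ = ε / 2 := by field_simp
  have hπ : 0 < (2 * π)⁻¹ := by positivity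
  calc |(latticePotentialKernel 2 (w - c n) -
          (2 * π)⁻¹ * Real.log ((((w - c n) 0 : ℤ) : ℝ) ^ 2 + (((w - c n) 1 : ℤ) : ℝ) ^ 2) - κ) / 2 +
        (2 * π)⁻¹ * Real.log (dist (meshPoint (δ n) w) (meshPoint (δ n) (c n))) -
        (2 * π)⁻¹ * Real.log ‖meshPoint (δ n) w - u‖|
      = |(latticePotentialKernel 2 (w - c n) -
          (2 * π)⁻¹ * Real.log ((((w - c n) 0 : ℤ) : ℝ) ^ 2 + (((w - c n) 1 : ℤ) : ℝ) ^ 2) - κ) / 2 +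
        (2 * π)⁻¹ * (Real.log (dist (meshPoint (δ n) w) (meshPoint (δ n) (c n))) -
          Real.log ‖meshPoint (δ n) w - u‖)| := by ring_nf
    _ ≤ |(latticePotentialKernel 2 (w - c n) -
          (2 * π)⁻¹ * Real.log ((((w - c n) 0 : ℤ) : ℝ) ^ 2 + (((w - c n) 1 : ℤ) : ℝ) ^ 2) - κ) / 2| +
        |(2 * π)⁻¹ * (Real.log (dist (meshPoint (δ n) w) (meshPoint (δ n) (c n))) -
          Real.log ‖meshPoint (δ n) w - u‖)| := abs_add_le _ _
    _ ≤ ε / 2 + ε / 2 := by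
        refine add_le_add ?_ ?_
        · rw [abs_div, abs_two]; linarith
        · rw [abs_mul, abs_of_pos hπ]
          exact (mul_le_mul_of_nonneg_left hlog hπ.le).trans hlog'
    _ = ε := by ring

/-- `|log t| ≤ max |log a| |log b|` for `0 < a ≤ t ≤ b`. [folklore] -/
theorem abs_log_le_max_of_mem_Icc {a b t : ℝ} (ha : 0 < a) (hat : a ≤ t) (htb : t ≤ b) :
    |Real.log t| ≤ max |Real.log a| |Real.log b| := by
  have h1 : Real.log a ≤ Real.log t := Real.log_le_log ha hat
  have h2 : Real.log t ≤ Real.log b := Real.log_le_log (ha.trans_le hat) htb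
  rw [abs_le]
  constructor
  · have : -max |Real.log a| |Real.log b| ≤ Real.log a := by
      have := neg_abs_le (Real.log a)
      have := le_max_left |Real.log a| |Real.log b|
      linarith
    linarith
  · have : Real.log b ≤ max |Real.log a| |Real.log b| :=
      (le_abs_self _).trans (le_max_right _ _)
    linarith

/-- **A global bound for the normalised Green function.** If the sites outside `Vₙ` stay at
distance `≥ r_u` from the pole and the outer boundary sites stay within distance `R_u` of it,
then eventually `|G_{Vₙ}(cₙ, ·) + a(· - cₙ)/2 - Lₙ| ≤ (2π)⁻¹ max |log r_u| |log R_u| + 1` on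
`Vₙ` and on its outer boundary (boundary data + the discrete maximum principle, the normalised
Green function being lattice harmonic on all of `Vₙ`). [folklore] -/
theorem abs_greenNormalised_le {r_u R_u : ℝ} (hru : 0 < r_u)
    (hδ : ∀ n, 0 < δ n) (hδ0 : Tendsto δ atTop (𝓝 0))
    (hfar : ∀ᶠ n in atTop, ∀ w : Site 2, w ∉ V n → r_u ≤ dist (meshPoint (δ n) w) u)
    (hnear : ∀ᶠ n in atTop, ∀ w ∈ latticeOuterBoundary (↑(V n) : Set (Site 2)),
      dist (meshPoint (δ n) w) u ≤ R_u)
    (hcu : Tendsto (fun n => meshPoint (δ n) (c n)) atTop (𝓝 u))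
    (hA : Tendsto (fun y : Site 2 => latticePotentialKernel 2 y -
      (2 * π)⁻¹ * Real.log (((y 0 : ℤ) : ℝ) ^ 2 + ((y 1 : ℤ) : ℝ) ^ 2)) cofinite (𝓝 κ)) :
    ∀ᶠ n in atTop, ∀ y ∈ (↑(V n) : Set (Site 2)) ∪ latticeOuterBoundary (↑(V n) : Set (Site 2)),
      |dirichletGreen (V n) (c n) y + latticePotentialKernel 2 (y - c n) / 2 -
          (-(2 * π)⁻¹ * Real.log (δ n) + κ / 2)| ≤
        (2 * π)⁻¹ * max |Real.log r_u| |Real.log R_u| + 1 := by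
  filter_upwards [greenNormalised_data_of_far hru hδ hδ0 hfar hcu hA one_pos, hfar, hnear]
    with n hn hfarn hnearn
  set F : Site 2 → ℝ := fun y => dirichletGreen (V n) (c n) y + latticePotentialKernel 2 (y - c n) / 2 -
      (-(2 * π)⁻¹ * Real.log (δ n) + κ / 2) with hF
  set B : ℝ := (2 * π)⁻¹ * max |Real.log r_u| |Real.log R_u| + 1 with hB
  -- on the outer boundary
  have hbdry : ∀ w ∈ latticeOuterBoundary (↑(V n) : Set (Site 2)), |F w| ≤ B := by
    intro w hw
    have h1 := hn w hw
    have hwV : w ∉ V n := fun h => hw.1 (Finset.mem_coe.2 h)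
    have hlo : r_u ≤ ‖meshPoint (δ n) w - u‖ := by rw [← dist_eq_norm]; exact hfarn w hwV
    have hhi : ‖meshPoint (δ n) w - u‖ ≤ R_u := by rw [← dist_eq_norm]; exact hnearn w hw
    have h2 : |(2 * π)⁻¹ * Real.log ‖meshPoint (δ n) w - u‖| ≤ (2 * π)⁻¹ * max |Real.log r_u| |Real.log R_u| := by
      rw [abs_mul, abs_of_pos (by positivity : (0 : ℝ) < (2 * π)⁻¹)]
      exact mul_le_mul_of_nonneg_left (abs_log_le_max_of_mem_Icc hru hlo hhi) (by positivity)
    have h3 : |F w| ≤ |F w - (2 * π)⁻¹ * Real.log ‖meshPoint (δ n) w - u‖| +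
        |(2 * π)⁻¹ * Real.log ‖meshPoint (δ n) w - u‖| := by
      have := abs_add_le (F w - (2 * π)⁻¹ * Real.log ‖meshPoint (δ n) w - u‖)
        ((2 * π)⁻¹ * Real.log ‖meshPoint (δ n) w - u‖)
      rwa [sub_add_cancel] at this
    have h1' : |F w - (2 * π)⁻¹ * Real.log ‖meshPoint (δ n) w - u‖| ≤ 1 := h1
    linarith
  -- inside by the maximum principle (`F` is harmonic on `V n`)
  have hharm : IsLatticeHarmonicOn F ↑(V n) := isLatticeHarmonicOn_greenNormalised (V n) (c n) _
  have hfin : (↑(V n) : Set (Site 2)).Finite := (V n).finite_toSet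
  have hup : ∀ y ∈ (↑(V n) : Set (Site 2)), F y ≤ B :=
    hharm.subharmonicOn.le_of_forall_boundary_le hfin fun w hw => (le_abs_self _).trans (hbdry w hw)
  have hdown : ∀ y ∈ (↑(V n) : Set (Site 2)), -B ≤ F y :=
    hharm.superharmonicOn.ge_of_forall_boundary_ge hfin fun w hw => (abs_le.1 (hbdry w hw)).1
  intro y hy
  rcases hy with hy | hy
  · exact abs_le.2 ⟨hdown y hy, hup y hy⟩
  · exact hbdry y hy

end Normalised


/-! ### D. Compactness for eventually lattice-harmonic functions -/

section Compactness

/-! ### Distances of mesh points -/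

/-- Sup-distance of two sites from the distance of their mesh points. [folklore] -/
private theorem abs_sub_le_of_norm_meshPoint_le_aux {δ : ℝ} (hδ : 0 < δ) {v v' : Site 2} {R : ℝ}
    (h : ‖meshPoint δ v - meshPoint δ v'‖ ≤ δ * R) :
    |((v 0 - v' 0 : ℤ) : ℝ)| ≤ R ∧ |((v 1 - v' 1 : ℤ) : ℝ)| ≤ R := by
  have hre := (abs_re_le_norm _).trans h
  have him := (abs_im_le_norm _).trans h
  rw [sub_re, meshPoint_re, meshPoint_re, ← mul_sub, abs_mul, abs_of_pos hδ] at hre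
  rw [sub_im, meshPoint_im, meshPoint_im, ← mul_sub, abs_mul, abs_of_pos hδ] at him
  push_cast
  exact ⟨le_of_mul_le_mul_left hre hδ, le_of_mul_le_mul_left him hδ⟩

/-- Distance of mesh points from the `ℓ¹`-distance of sites. [folklore] -/
private theorem norm_meshPoint_sub_le_aux {δ : ℝ} (hδ : 0 ≤ δ) (v v' : Site 2) :
    ‖meshPoint δ v - meshPoint δ v'‖ ≤ δ * (|((v 0 - v' 0 : ℤ) : ℝ)| + |((v 1 - v' 1 : ℤ) : ℝ)|) := by
  have h := norm_le_abs_re_add_abs_im (meshPoint δ v - meshPoint δ v')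
  rw [sub_re, meshPoint_re, meshPoint_re, ← mul_sub, sub_im, meshPoint_im, meshPoint_im, ← mul_sub,
    abs_mul, abs_mul, abs_of_nonneg hδ] at h
  push_cast
  linarith

/-- **Subsequential local uniform limits of locally bounded, eventually lattice-harmonic
functions** — the compactness theorem `exists_subseq_tendstoUniformlyOn_of_latticeHarmonic` of
`LatticeHarmonicCompactness.lean` with harmonicity of `P n` only required EVENTUALLY on each
compact subset of `D` (the form needed under Carathéodory convergence, where the discrete domains
exhaust `D` only in the limit): for `δ n → 0⁺` and lattice functions `P n` that are, for every
compact `K ⊆ D`, eventually lattice-harmonic at every site whose closed mesh disc lies in `K` and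
eventually-uniformly bounded at the sites with mesh point in `K`, some subsequence of the step
functions `z ↦ P n (nearestSite (δ n) z)` converges uniformly on compact subsets of `D` to a
function continuous on `D`. The proof is that of the cited theorem, verbatim up to the extra
eventuality (Chelkak–Smirnov 2011, Prop. 3.1). [folklore] -/
theorem exists_subseq_tendstoUniformlyOn_of_eventually_latticeHarmonic {D : Set ℂ} (hD : IsOpen D)
    {δ : ℕ → ℝ} (hδ : ∀ n, 0 < δ n) (hδ0 : Tendsto δ atTop (𝓝 0)) (P : ℕ → Site 2 → ℝ)
    (hharm : ∀ K ⊆ D, IsCompact K → ∀ᶠ n in atTop, ∀ v : Site 2,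
      closedBall (meshPoint (δ n) v) (δ n) ⊆ K → latticeLaplacian (P n) v = 0)
    (hbdd : ∀ K ⊆ D, IsCompact K → ∃ M : ℝ, ∀ᶠ n in atTop, ∀ v : Site 2,
      meshPoint (δ n) v ∈ K → |P n v| ≤ M) :
    ∃ φ : ℕ → ℕ, StrictMono φ ∧ ∃ H : ℂ → ℝ, ContinuousOn H D ∧
      ∀ K ⊆ D, IsCompact K →
        TendstoUniformlyOn (fun n z => P (φ n) (nearestSite (δ (φ n)) z)) H atTop K := by
  set u : ℕ → ℂ → ℂ := fun n z => ((P n (nearestSite (δ n) z) : ℝ) : ℂ) with hu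
  -- a compact neighbourhood inside `D` of a compact `K ⊆ D`, with a bound there
  have hnbhd : ∀ K ⊆ D, IsCompact K → ∃ r > 0, cthickening r K ⊆ D ∧ IsCompact (cthickening r K) ∧
      ∃ M : ℝ, 0 ≤ M ∧ ∀ᶠ n in atTop, ∀ v : Site 2, meshPoint (δ n) v ∈ cthickening r K → |P n v| ≤ M := by
    intro K hKD hK
    obtain ⟨r, hr, hrD⟩ := hK.exists_cthickening_subset_open hD hKD
    obtain ⟨M, hM⟩ := hbdd _ hrD (hK.cthickening)
    refine ⟨r, hr, hrD, hK.cthickening, max M 0, le_max_right _ _, ?_⟩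
    filter_upwards [hM] with n hn v hv
    exact (hn v hv).trans (le_max_left _ _)
  -- uniform bounds
  have hbdd' : ∀ K ⊆ D, IsCompact K → ∃ M : ℝ, ∀ᶠ n in atTop, ∀ z ∈ K, ‖u n z‖ ≤ M := by
    intro K hKD hK
    obtain ⟨r, hr, -, -, M, -, hM⟩ := hnbhd K hKD hK
    refine ⟨M, ?_⟩
    filter_upwards [hM, hδ0.eventually (gt_mem_nhds hr)] with n hn hnr z hz
    simp only [hu, norm_real, Real.norm_eq_abs]
    apply hn
    exact mem_cthickening_of_dist_le _ z _ _ hz ((dist_meshPoint_nearestSite_le (hδ n) z).trans hnr.le)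
  -- asymptotic equicontinuity
  have hequi : ∀ K ⊆ D, IsCompact K → ∃ L : ℝ, 0 ≤ L ∧ ∀ᶠ n in atTop, ∀ z ∈ K, ∀ z' ∈ K,
      ‖u n z - u n z'‖ ≤ L * (‖z - z'‖ + 2 * δ n) := by
    intro K hKD hK
    obtain ⟨r, hr, hrD, hrK, M, hM0, hM⟩ := hnbhd K hKD hK
    set ρ := r / 4 with hρ
    have hρ0 : 0 < ρ := by positivity
    set C := topGradConst with hC
    have hC0 : 0 < C := topGradConst_pos
    refine ⟨32 * (C + 1) * M / ρ, by positivity, ?_⟩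
    filter_upwards [hM, hδ0.eventually (gt_mem_nhds (show 0 < ρ / 80 by positivity)),
      hharm _ hrD hrK] with n hn hnρ hharmn z hz z' hz'
    set d := δ n with hd
    have hd0 : 0 < d := hδ n
    -- the box scale
    set N := ⌊ρ / (2 * d)⌋₊ with hN
    have hNle : (N : ℝ) ≤ ρ / (2 * d) := Nat.floor_le (by positivity)
    have hNge : ρ / (2 * d) - 1 ≤ N := by
      have := Nat.lt_floor_add_one (ρ / (2 * d)); linarith
    have hρd : 40 ≤ ρ / (2 * d) := by rw [le_div_iff₀ (by positivity)]; linarith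
    have hN16 : 16 ≤ N := by
      have : (16 : ℝ) ≤ N := by linarith
      exact_mod_cast this
    have hNd : (N : ℝ) * d ≤ ρ / 2 := by
      have := (le_div_iff₀ (by positivity : (0 : ℝ) < 2 * d)).1 hNle
      linarith
    -- sites near `nearestSite z` are well inside `D`, where `|P n| ≤ M`
    set v := nearestSite d z with hv
    have hvz : dist (meshPoint d v) z ≤ d := dist_meshPoint_nearestSite_le hd0 z
    have hnear : ∀ x : Site 2, |x 0 - v 0| ≤ N → |x 1 - v 1| ≤ N →
        closedBall (meshPoint d x) d ⊆ cthickening r K := by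
      intro x hx0 hx1 p hp
      rw [mem_closedBall] at hp
      have hxv := dist_meshPoint_le_of_abs_le hd0.le hx0 hx1
      push_cast at hxv
      apply mem_cthickening_of_dist_le p z r K hz
      calc dist p z ≤ dist p (meshPoint d x) + dist (meshPoint d x) (meshPoint d v) + dist (meshPoint d v) z :=
            dist_triangle4 _ _ _ _
        _ ≤ d + d * (2 * N) + d := by linarith
        _ ≤ r := by nlinarith
    have hharm' : ∀ x : Site 2, |x 0 - v 0| ≤ N → |x 1 - v 1| ≤ N → latticeLaplacian (P n) x = 0 :=
      fun x hx0 hx1 => hharmn x (hnear x hx0 hx1)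
    have hM' : ∀ x : Site 2, |x 0 - v 0| ≤ N → |x 1 - v 1| ≤ N → |P n x| ≤ M :=
      fun x hx0 hx1 => hn x (hnear x hx0 hx1 (mem_closedBall_self hd0.le))
    -- the gradient bound on the box of radius `N/4 - 1`
    have hgrad : ∀ x : Site 2, |x 0 - v 0| ≤ (N / 4 : ℕ) - 1 → |x 1 - v 1| ≤ (N / 4 : ℕ) - 1 →
        ∀ k : Fin 4, |P n (x + cornerUnit k) - P n x| ≤ 4 * C * M / N :=
      fun x hx0 hx1 k => abs_step_le_of_harmonic_box hN16 hharm' hM0 hM' hx0 hx1 k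
    have hg0 : 0 ≤ 4 * C * M / N := by positivity
    have hgle : 4 * C * M / N ≤ 16 * C * M * d / ρ := by
      have hNpos : (0 : ℝ) < N := by exact_mod_cast (show 0 < N by omega)
      rw [div_le_div_iff₀ hNpos hρ0]
      have : ρ ≤ 4 * N * d := by
        have h1 : ρ / (2 * d) - 1 ≤ N := hNge
        rw [div_sub_one (by positivity), div_le_iff₀ (by positivity)] at h1
        nlinarith
      nlinarith [mul_nonneg (mul_nonneg (by norm_num : (0:ℝ) ≤ 4) hC0.le) hM0]
    -- the two cases: close or far
    by_cases hclose : ‖z - z'‖ ≤ ρ / 16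
    · set v' := nearestSite d z' with hv'
      have hv'z' : dist (meshPoint d v') z' ≤ d := dist_meshPoint_nearestSite_le hd0 z'
      have hvv' : ‖meshPoint d v' - meshPoint d v‖ ≤ d * ((‖z - z'‖ + 2 * d) / d) := by
        rw [mul_div_cancel₀ _ hd0.ne', ← dist_eq_norm]
        calc dist (meshPoint d v') (meshPoint d v) ≤ dist (meshPoint d v') z' + dist z' z + dist z (meshPoint d v) :=
              dist_triangle4 _ _ _ _
          _ ≤ d + ‖z - z'‖ + d := by
              have e1 : dist z' z = ‖z - z'‖ := by rw [dist_comm, dist_eq_norm]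
              have e2 : dist z (meshPoint d v) ≤ d := by rw [dist_comm]; exact hvz
              linarith [hv'z']
          _ = ‖z - z'‖ + 2 * d := by ring
      obtain ⟨h0, h1⟩ := abs_sub_le_of_norm_meshPoint_le_aux hd0 hvv'
      have hRle : (‖z - z'‖ + 2 * d) / d ≤ ((N / 4 : ℕ) : ℝ) - 1 := by
        have h4 : ((N : ℝ) - 3) / 4 ≤ ((N / 4 : ℕ) : ℝ) := by
          have : (N : ℤ) ≤ 4 * ((N / 4 : ℕ) : ℤ) + 3 := by omega
          have : (N : ℝ) ≤ 4 * ((N / 4 : ℕ) : ℝ) + 3 := by exact_mod_cast this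
          linarith
        rw [div_le_iff₀ hd0]
        have h5 : ρ / (2 * d) - 1 ≤ N := hNge
        rw [div_sub_one (by positivity), div_le_iff₀ (by positivity)] at h5
        have h6 : ((N : ℝ) - 3) / 4 * d ≤ ((N / 4 : ℕ) : ℝ) * d := mul_le_mul_of_nonneg_right h4 hd0.le
        linarith
      have h0' : |v' 0 - v 0| ≤ ((N / 4 : ℕ) : ℤ) - 1 := by
        have : (|((v' 0 - v 0 : ℤ) : ℝ)|) ≤ ((N / 4 : ℕ) : ℝ) - 1 := h0.trans hRle
        exact_mod_cast this
      have h1' : |v' 1 - v 1| ≤ ((N / 4 : ℕ) : ℤ) - 1 := by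
        have : (|((v' 1 - v 1 : ℤ) : ℝ)|) ≤ ((N / 4 : ℕ) : ℝ) - 1 := h1.trans hRle
        exact_mod_cast this
      have hkey := abs_sub_le_of_gradient hgrad h0' h1'
      simp only [hu, ← ofReal_sub, norm_real, Real.norm_eq_abs, ← hv, ← hv', ← hd]
      rw [abs_sub_comm]
      calc |P n v' - P n v| ≤ 4 * C * M / N * (|((v' 0 - v 0 : ℤ) : ℝ)| + |((v' 1 - v 1 : ℤ) : ℝ)|) := hkey
        _ ≤ 16 * C * M * d / ρ * (2 * ((‖z - z'‖ + 2 * d) / d)) :=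
            mul_le_mul hgle (by linarith) (by positivity) (by positivity)
        _ = 32 * C * M / ρ * (‖z - z'‖ + 2 * d) := by field_simp; ring
        _ ≤ 32 * (C + 1) * M / ρ * (‖z - z'‖ + 2 * d) := by
            apply mul_le_mul_of_nonneg_right _ (by positivity)
            apply div_le_div_of_nonneg_right _ hρ0.le
            nlinarith
    · push Not at hclose
      have hb : ∀ w ∈ K, ‖u n w‖ ≤ M := by
        intro w hw
        simp only [hu, norm_real, Real.norm_eq_abs]
        apply hn
        apply mem_cthickening_of_dist_le _ w _ _ hw
        exact (dist_meshPoint_nearestSite_le hd0 w).trans (by linarith)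
      calc ‖u n z - u n z'‖ ≤ ‖u n z‖ + ‖u n z'‖ := norm_sub_le _ _
        _ ≤ M + M := add_le_add (hb z hz) (hb z' hz')
        _ = 32 * M / ρ * (ρ / 16) := by field_simp; ring
        _ ≤ 32 * (C + 1) * M / ρ * (‖z - z'‖ + 2 * d) := by
            apply mul_le_mul _ (by linarith) (by positivity) (by positivity)
            apply div_le_div_of_nonneg_right _ hρ0.le
            nlinarith
  -- extraction
  have hε : Tendsto (fun n => 2 * δ n) atTop (𝓝 0) := by simpa using hδ0.const_mul 2
  obtain ⟨φ, hφ, g, hgc, hg⟩ :=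
    exists_subseq_tendstoUniformlyOn_of_asympEquicontinuous hD u (fun n => 2 * δ n) hε hbdd' hequi
  refine ⟨φ, hφ, fun z => (g z).re, continuous_re.comp_continuousOn hgc, fun K hKD hK => ?_⟩
  have h1 := Complex.reCLM.uniformContinuous.comp_tendstoUniformlyOn (hg K hKD hK)
  refine h1.congr (Eventually.of_forall fun n => ?_)
  intro z _
  simp [hu]

end Compactness


/-! ### E. Boundary values of eventually-bounded lattice-harmonic functions near an exterior site
(two-constant bound + weak Beurling estimate) -/

section BoundaryControl

open WeakBeurling

variable {δ : ℕ → ℝ} {V : ℕ → Finset (Site 2)} {F : ℕ → Site 2 → ℝ}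

/-- Outer boundary sites of `T = V ∩ S` lie in `V` or in the outer boundary of `V`. [folklore] -/
theorem mem_union_latticeOuterBoundary_of_mem_latticeOuterBoundary_inter {W S : Set (Site 2)}
    {w : Site 2} (hw : w ∈ latticeOuterBoundary (W ∩ S)) : w ∈ W ∪ latticeOuterBoundary W := by
  by_cases hwW : w ∈ W
  · exact Or.inl hwW
  · obtain ⟨v, hv, k, hk⟩ := hw.2
    exact Or.inr ⟨hwW, v, hv.1, k, hk⟩

/-- An outer boundary site of `T = V ∩ S` inside `S` is an outer boundary site of `V`. [folklore] -/
theorem mem_latticeOuterBoundary_of_mem_latticeOuterBoundary_inter_of_mem {W S : Set (Site 2)}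
    {w : Site 2} (hw : w ∈ latticeOuterBoundary (W ∩ S)) (hwS : w ∈ S) :
    w ∈ latticeOuterBoundary W := by
  have hwW : w ∉ W := fun h => hw.1 ⟨h, hwS⟩
  obtain ⟨v, hv, k, hk⟩ := hw.2
  exact ⟨hwW, v, hv.1, k, hk⟩

/-- Affine images `(F - m)/B` (`B > 0`) of lattice-harmonic functions are subharmonic. [folklore] -/
theorem isLatticeSubharmonicOn_sub_div {H : Site 2 → ℝ} {S : Set (Site 2)} (hH : IsLatticeHarmonicOn H S)
    (m B : ℝ) : IsLatticeSubharmonicOn (fun y => (H y - m) / B) S := by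
  intro v hv
  have h1 : (fun y => (H y - m) / B) = fun y => B⁻¹ * (fun x => H x + (-m)) y := by
    funext y; simp only; ring
  rw [h1, latticeLaplacian_const_mul, latticeLaplacian_add_const, hH v hv, mul_zero]

/-- Affine images `(m - F)/B` of lattice-harmonic functions are subharmonic. [folklore] -/
theorem isLatticeSubharmonicOn_const_sub_div {H : Site 2 → ℝ} {S : Set (Site 2)} (hH : IsLatticeHarmonicOn H S)
    (m B : ℝ) : IsLatticeSubharmonicOn (fun y => (m - H y) / B) S := by
  intro v hv
  have h1 : (fun y => (m - H y) / B) = fun y => (-B⁻¹) * (fun x => H x + (-m)) y := by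
    funext y; simp only; ring
  rw [h1, latticeLaplacian_const_mul, latticeLaplacian_add_const, hH v hv, mul_zero]

/-- Coordinates of two sites whose mesh points are both within `r` of a point differ by at most
`2r/δ`. [folklore] -/
theorem abs_sub_le_of_dist_meshPoint_lt {d : ℝ} (hd : 0 < d) {y p : Site 2} {a : ℂ} {r : ℝ}
    (hy : dist (meshPoint d y) a < r) (hp : dist (meshPoint d p) a < r) (i : Fin 2) :
    (|((y i - p i : ℤ) : ℝ)|) ≤ 2 * r / d := by
  have h1 : dist (meshPoint d y) (meshPoint d p) < 2 * r := by
    calc dist (meshPoint d y) (meshPoint d p) ≤ dist (meshPoint d y) a + dist (meshPoint d p) a :=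
          dist_triangle_right _ _ _
      _ < 2 * r := by linarith
  rw [le_div_iff₀ hd]
  have hre := abs_re_le_norm (meshPoint d y - meshPoint d p)
  have him := abs_im_le_norm (meshPoint d y - meshPoint d p)
  rw [sub_re, meshPoint_re, meshPoint_re, ← mul_sub, abs_mul, abs_of_pos hd] at hre
  rw [sub_im, meshPoint_im, meshPoint_im, ← mul_sub, abs_mul, abs_of_pos hd] at him
  rw [← dist_eq_norm] at hre him
  fin_cases i
  · push_cast; nlinarith
  · push_cast; nlinarith

/-- **Boundary values are taken on, uniformly at the lattice scale** (the step "`H_j` is small on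
`a^δ b^δ ∖ W`" of Smirnov 2010, Lemma B.3, in the form needed for Carathéodory approximations).
Let `Vₙ ⊆ ℤ²` be finite and hole-free, `Fₙ` lattice harmonic on `Vₙ`, eventually bounded by `B`
on `Vₙ` and its outer boundary, with outer boundary values `Φ(δₙ w) + o(1)` for a function `Φ`
continuous at the point `a`; suppose that at every distance from `a` there is eventually a site
OUTSIDE `Vₙ`. Then for every `ε > 0` there is `r > 0` such that eventually `|Fₙ y - Φ a| ≤ ε`
at every `y ∈ Vₙ` with `‖δₙ y - a‖ < r`. Proof: two-constant bound on `Vₙ ∩ (box of size ≍ r₁)`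
around the exterior site, the far boundary weighted by the weak Beurling estimate
(`le_add_rpow_of_cutPath`), the cut path being the hole-free escape path of the exterior site.
[cite: Smirnov2010, Appendix B, proof of Lemma B.3] -/
theorem eventually_abs_sub_le_near_of_holeFree (hδ : ∀ n, 0 < δ n) (hδ0 : Tendsto δ atTop (𝓝 0))
    (hV : ∀ n, HoleFree (↑(V n) : Set (Site 2)))
    (hharm : ∀ n, IsLatticeHarmonicOn (F n) ↑(V n)) {B : ℝ} (hB : 0 ≤ B)
    (hbd : ∀ᶠ n in atTop, ∀ y ∈ (↑(V n) : Set (Site 2)) ∪ latticeOuterBoundary (↑(V n) : Set (Site 2)),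
      |F n y| ≤ B)
    {Φ : ℂ → ℝ} {a : ℂ} (hΦ : ContinuousAt Φ a)
    (hdata : ∀ ε : ℝ, 0 < ε → ∀ᶠ n in atTop, ∀ w ∈ latticeOuterBoundary (↑(V n) : Set (Site 2)),
      |F n w - Φ (meshPoint (δ n) w)| ≤ ε)
    (hout : ∀ ρ : ℝ, 0 < ρ → ∀ᶠ n in atTop, ∃ p : Site 2, p ∉ V n ∧ dist (meshPoint (δ n) p) a < ρ)
    {ε : ℝ} (hε : 0 < ε) :
    ∃ r : ℝ, 0 < r ∧ ∀ᶠ n in atTop, ∀ y ∈ V n, dist (meshPoint (δ n) y) a < r → |F n y - Φ a| ≤ ε := by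
  -- continuity of `Φ` at `a`
  obtain ⟨r₁, hr₁, hr₁Φ⟩ : ∃ r₁ : ℝ, 0 < r₁ ∧ ∀ w : ℂ, dist w a < r₁ → |Φ w - Φ a| ≤ ε / 3 := by
    have := Metric.continuousAt_iff.1 hΦ (ε / 3) (by positivity)
    obtain ⟨r₁, hr₁, h⟩ := this
    exact ⟨r₁, hr₁, fun w hw => by have := h hw; rw [Real.dist_eq] at this; exact this.le⟩
  -- the Beurling ratio `t`
  set B' : ℝ := B + |Φ a| + 1 with hB'
  have hB'0 : 0 < B' := by positivity
  set C : ℝ := beurlingConst with hC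
  set β : ℝ := beurlingExp with hβ
  have hC0 : 0 < C := beurlingConst_pos
  have hβ0 : 0 < β := beurlingExp_pos
  obtain ⟨t, ht0, ht1, ht⟩ : ∃ t : ℝ, 0 < t ∧ t ≤ 1 ∧ ∀ x : ℝ, 0 ≤ x → x < t → B' * C * x ^ β ≤ ε / 3 := by
    have hcont : Tendsto (fun x : ℝ => B' * C * x ^ β) (𝓝 0) (𝓝 0) := by
      have h1 : ContinuousAt (fun x : ℝ => x ^ β) 0 := Real.continuousAt_rpow_const 0 β (Or.inr hβ0.le)
      have h2 := h1.tendsto.const_mul (B' * C)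
      rwa [Real.zero_rpow hβ0.ne', mul_zero] at h2
    have hev : ∀ᶠ x in 𝓝 (0 : ℝ), B' * C * x ^ β < ε / 3 := (tendsto_order.1 hcont).2 _ (by positivity)
    obtain ⟨t, ht0, ht⟩ := Metric.eventually_nhds_iff.1 hev
    refine ⟨min t 1, lt_min ht0 one_pos, min_le_right _ _, fun x hx0 hxt => (ht ?_).le⟩
    rw [Real.dist_eq, sub_zero, abs_of_nonneg hx0]
    exact hxt.trans_le (min_le_left _ _)
  -- the final radius
  set r : ℝ := t * r₁ / 16 with hr
  have hr0 : 0 < r := by positivity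
  refine ⟨r, hr0, ?_⟩
  filter_upwards [hbd, hdata (ε / 3) (by positivity), hout r hr0,
    hδ0.eventually (gt_mem_nhds (show 0 < t * r₁ / 16 by positivity))] with n hbdn hdatan houtn hδn
  obtain ⟨p, hpV, hpa⟩ := houtn
  set d : ℝ := δ n with hd
  have hd0 : 0 < d := hδ n
  have hdt : d < t * r₁ / 16 := hδn
  have hd16 : d < r₁ / 16 := by
    calc d < t * r₁ / 16 := hdt
      _ ≤ 1 * r₁ / 16 := by gcongr
      _ = r₁ / 16 := by ring
  -- the two lattice scales
  set R : ℕ := ⌊r₁ / (4 * d)⌋₊ with hR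
  set ρ : ℕ := ⌈2 * r / d⌉₊ with hρ
  have hRle : (R : ℝ) ≤ r₁ / (4 * d) := Nat.floor_le (by positivity)
  have hRge : r₁ / (4 * d) - 1 ≤ R := by have := Nat.lt_floor_add_one (r₁ / (4 * d)); linarith
  have hρge : 2 * r / d ≤ ρ := Nat.le_ceil _
  have hρle : (ρ : ℝ) ≤ 2 * r / d + 1 := (Nat.ceil_lt_add_one (by positivity)).le
  have hρR : ρ ≤ R := by
    have h1 : (ρ : ℝ) ≤ R := by
      have hA : 2 * r ≤ r₁ / 8 := by rw [hr]; nlinarith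
      have h2 : 2 * r / d + 1 ≤ r₁ / (4 * d) - 1 := by
        rw [div_add_one hd0.ne', div_sub_one (by positivity), div_le_div_iff₀ hd0 (by positivity)]
        nlinarith [mul_le_mul_of_nonneg_right hA (by positivity : (0:ℝ) ≤ d), mul_lt_mul_of_pos_right hd16 hd0]
      linarith
    exact_mod_cast h1
  have hratio : ((ρ : ℝ) + 1) / ((R : ℝ) + 1) < t := by
    have hRpos : (0 : ℝ) < (R : ℝ) + 1 := by positivity
    rw [div_lt_iff₀ hRpos]
    have h1 : (ρ : ℝ) + 1 ≤ t * r₁ / (8 * d) + 2 := by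
      have : 2 * r / d = t * r₁ / (8 * d) := by rw [hr]; field_simp; ring
      linarith
    have h2 : r₁ / (4 * d) ≤ (R : ℝ) + 1 := by linarith
    have hkey : 2 < t * r₁ / (8 * d) := by rw [lt_div_iff₀ (by positivity)]; linarith
    calc (ρ : ℝ) + 1 ≤ t * r₁ / (8 * d) + 2 := h1
      _ < t * r₁ / (8 * d) + t * r₁ / (8 * d) := by linarith
      _ = t * (r₁ / (4 * d)) := by field_simp; ring
      _ ≤ t * ((R : ℝ) + 1) := mul_le_mul_of_nonneg_left h2 ht0.le
  have hratio0 : (0 : ℝ) ≤ ((ρ : ℝ) + 1) / ((R : ℝ) + 1) := by positivity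
  -- the cut path: the hole-free escape of `p` leaves the box `sqBox p R`
  obtain ⟨g', hg'1, hg'⟩ := hV n p (fun h => hpV (Finset.mem_coe.1 h)) (p 1 + R + 1)
  obtain ⟨q, hq⟩ := exists_walk_of_faceStep hg' (fun h => hpV (Finset.mem_coe.1 h))
  have hg'box : g' ∉ sqBox p R := by
    intro h
    rw [mem_sqBox] at h
    have := (abs_le.1 h.2).2
    omega
  -- the two-constant bound on `T = V n ∩ sqBox p R`
  set T : Set (Site 2) := (↑(V n) : Set (Site 2)) ∩ sqBox p R with hT
  have hTfin : T.Finite := (V n).finite_toSet.subset inter_subset_left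
  have hqT : ∀ z ∈ q.support, z ∉ T := fun z hz h => hq z hz h.1
  have hharmT : IsLatticeHarmonicOn (F n) T := fun v hv => hharm n v hv.1
  -- bounds on the outer boundary of `T`
  have h1T : ∀ w ∈ latticeOuterBoundary T, |F n w - Φ a| ≤ B' := by
    intro w hw
    have hw' := mem_union_latticeOuterBoundary_of_mem_latticeOuterBoundary_inter hw
    have := hbdn w hw'
    calc |F n w - Φ a| ≤ |F n w| + |Φ a| := abs_sub _ _
      _ ≤ B + |Φ a| := by linarith
      _ ≤ B' := by rw [hB']; linarith
  have hboxdist : ∀ w ∈ sqBox p R, dist (meshPoint d w) a < r₁ := by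
    intro w hw
    rw [mem_sqBox] at hw
    have h1 := dist_meshPoint_le_of_abs_le hd0.le hw.1 hw.2
    have h2 : d * (2 * (R : ℤ)) ≤ r₁ / 2 := by
      push_cast
      have := (le_div_iff₀ (by positivity : (0 : ℝ) < 4 * d)).1 hRle
      nlinarith
    have h3 : dist (meshPoint d p) a < r₁ / 16 := by
      calc dist (meshPoint d p) a < r := hpa
        _ ≤ 1 * r₁ / 16 := by rw [hr]; gcongr
        _ = r₁ / 16 := by ring
    calc dist (meshPoint d w) a ≤ dist (meshPoint d w) (meshPoint d p) + dist (meshPoint d p) a :=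
          dist_triangle _ _ _
      _ < r₁ / 2 + r₁ / 16 := by linarith
      _ < r₁ := by linarith
  have hηT : ∀ w ∈ latticeOuterBoundary T, w ∈ sqBox p R → |F n w - Φ a| ≤ 2 * ε / 3 := by
    intro w hw hwR
    have hw' := mem_latticeOuterBoundary_of_mem_latticeOuterBoundary_inter_of_mem hw hwR
    have e1 := hdatan w hw'
    have e2 := hr₁Φ (meshPoint d w) (hboxdist w hwR)
    calc |F n w - Φ a| = |(F n w - Φ (meshPoint d w)) + (Φ (meshPoint d w) - Φ a)| := by ring_nf
      _ ≤ |F n w - Φ (meshPoint d w)| + |Φ (meshPoint d w) - Φ a| := abs_add_le _ _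
      _ ≤ ε / 3 + ε / 3 := add_le_add e1 e2
      _ = 2 * ε / 3 := by ring
  set η : ℝ := 2 * ε / 3 / B' with hη
  have hη0 : 0 ≤ η := by positivity
  -- the estimate at the sites near `a`
  intro y hy hya
  have hyρ : y ∈ sqBox p ρ := by
    rw [mem_sqBox]
    have h0 := abs_sub_le_of_dist_meshPoint_lt hd0 hya hpa 0
    have h1 := abs_sub_le_of_dist_meshPoint_lt hd0 hya hpa 1
    constructor
    · have : (|((y 0 - p 0 : ℤ) : ℝ)|) ≤ ρ := h0.trans hρge
      exact_mod_cast this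
    · have : (|((y 1 - p 1 : ℤ) : ℝ)|) ≤ ρ := h1.trans hρge
      exact_mod_cast this
  have hyT : y ∈ T := ⟨Finset.mem_coe.2 hy, sqBox_mono p (by exact_mod_cast hρR) hyρ⟩
  set θ : ℝ := ((ρ : ℝ) + 1) / ((R : ℝ) + 1) with hθ
  have hsmall : B' * C * θ ^ β ≤ ε / 3 := ht θ hratio0 hratio
  have hup : F n y - Φ a ≤ ε := by
    have key := le_add_rpow_of_cutPath hTfin (isLatticeSubharmonicOn_sub_div hharmT (Φ a) B')
      (fun w hw => by
        rw [div_le_one hB'0]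
        exact (le_abs_self _).trans (h1T w hw))
      hη0 (fun w hw hwR => by
        rw [hη]
        exact div_le_div_of_nonneg_right ((le_abs_self _).trans (hηT w hw hwR)) hB'0.le)
      q hg'box hqT hyT hyρ
    have k2 : (F n y - Φ a) / B' ≤ η + C * θ ^ β := key
    rw [div_le_iff₀ hB'0] at k2
    have k3 : (η + C * θ ^ β) * B' = 2 * ε / 3 + B' * C * θ ^ β := by rw [hη]; field_simp
    linarith
  have hdown : Φ a - F n y ≤ ε := by
    have key := le_add_rpow_of_cutPath hTfin (isLatticeSubharmonicOn_const_sub_div hharmT (Φ a) B')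
      (fun w hw => by
        rw [div_le_one hB'0]
        exact (le_abs_self _).trans ((abs_sub_comm _ _).le.trans (h1T w hw)))
      hη0 (fun w hw hwR => by
        rw [hη]
        refine div_le_div_of_nonneg_right ((le_abs_self _).trans ?_) hB'0.le
        rw [abs_sub_comm]; exact hηT w hw hwR)
      q hg'box hqT hyT hyρ
    have k2 : (Φ a - F n y) / B' ≤ η + C * θ ^ β := key
    rw [div_le_iff₀ hB'0] at k2
    have k3 : (η + C * θ ^ β) * B' = 2 * ε / 3 + B' * C * θ ^ β := by rw [hη]; field_simp
    linarith
  exact abs_le.2 ⟨by linarith, hup⟩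

end BoundaryControl


/-! ### G. Identification of subsequential limits and assembly -/

section Assembly

open UpperHalfPlane (upperHalfPlaneSet isOpen_upperHalfPlaneSet)
open InnerProductSpace
open Literature.Probability.RandomPlanarGeometry (continuousAt_logPotential green_nonneg
  tendsto_green_nhdsWithin_frontier harmonicOnNhd_greenPotential greenPotential_eq)

/-- A frontier point of an open set is not in the set. [folklore] -/
theorem not_mem_of_mem_frontier_of_isOpen {Ω : Set ℂ} (hΩ : IsOpen Ω) {a : ℂ} (ha : a ∈ frontier Ω) :
    a ∉ Ω := fun h => by
  have : a ∈ Ω ∩ frontier Ω := ⟨h, ha⟩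
  rw [hΩ.inter_frontier_eq] at this
  exact this

/-- **Uniqueness of the limit (maximum principle).** On a bounded open preconnected `Ω`, two
harmonic functions with the same boundary values `Φ` in the lim-sup sense coincide. [folklore] -/
theorem eqOn_of_harmonic_of_boundary {Ω : Set ℂ} {R : ℝ} (hΩ : IsOpen Ω) (hΩc : IsPreconnected Ω)
    (hΩR : Ω ⊆ ball (0 : ℂ) R) {H f : ℂ → ℝ} (hH : HarmonicOnNhd H Ω) (hf : HarmonicOnNhd f Ω)
    {Φ : ℂ → ℝ}
    (hHb : ∀ a ∈ frontier Ω, ∀ ε : ℝ, 0 < ε → ∀ᶠ z in 𝓝[Ω] a, |H z - Φ a| ≤ ε)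
    (hfb : ∀ a ∈ frontier Ω, ∀ ε : ℝ, 0 < ε → ∀ᶠ z in 𝓝[Ω] a, |f z - Φ a| ≤ ε) :
    EqOn H f Ω := by
  have hg : HarmonicOnNhd (H - f) Ω := hH.sub hf
  have hinf : ∀ (P : ℂ → Prop), ∀ᶠ z in cocompact ℂ ⊓ 𝓟 Ω, P z := by
    intro P
    rw [Filter.eventually_inf_principal]
    filter_upwards [(isCompact_closedBall (0 : ℂ) R).compl_mem_cocompact] with z hz hzΩ
    exact absurd (ball_subset_closedBall (hΩR hzΩ)) hz
  have hbdry : ∀ ζ ∈ frontier Ω, ∀ ε : ℝ, 0 < ε → ∀ᶠ z in 𝓝[Ω] ζ, |(H - f) z| ≤ ε := by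
    intro ζ hζ ε hε
    filter_upwards [hHb ζ hζ (ε / 2) (half_pos hε), hfb ζ hζ (ε / 2) (half_pos hε)] with z h1 h2
    rw [Pi.sub_apply]
    calc |H z - f z| = |(H z - Φ ζ) - (f z - Φ ζ)| := by ring_nf
      _ ≤ |H z - Φ ζ| + |f z - Φ ζ| := abs_sub _ _
      _ ≤ ε := by linarith
  have hle := Literature.Analysis.Complex.harmonic_le_of_frontier_of_cocompact hΩ hΩc hg (M := 0)
    (fun ζ hζ ε hε => (hbdry ζ hζ ε hε).mono fun z hz => by linarith [(abs_le.1 hz).2])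
    (fun ε hε => hinf _)
  have hge := Literature.Analysis.Complex.harmonic_ge_of_frontier_of_cocompact hΩ hΩc hg (M := 0)
    (fun ζ hζ ε hε => (hbdry ζ hζ ε hε).mono fun z hz => by linarith [(abs_le.1 hz).1])
    (fun ε hε => hinf _)
  intro z hz
  have h1 := hle z hz
  have h2 := hge z hz
  rw [Pi.sub_apply] at h1 h2
  linarith

variable {Ω : Set ℂ} {R : ℝ} {δ : ℕ → ℝ} {A : ℕ → Finset (Site 2)} {u v : ℂ} {x c : ℕ → Site 2}
  {κ : ℝ}

/-- **The core of the proof of Corollary 3.3, along a sequence of meshes.** Let `Ω ⊆ B(0, R)` be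
open with a conformal `φ : ℍ → Ω`, `δₙ → 0⁺`, `Aₙ ⊆ ℤ²` hole-free with polygonal representations
`δₙ • starDomain Aₙ ⊆ B(0, R)` converging to `Ω` in the kernel sense (interior balls eventually
inside; frontier points approximated by frontier points), poles `δₙ cₙ → v ∈ Ω` and evaluation
sites `δₙ xₙ → u ∈ Ω`. Then along a subsequence the normalised Green functions
`Fₙ = G_{Aₙ}(cₙ, ·) + a(· − cₙ)/2 − Lₙ` (`Lₙ = −(2π)⁻¹ log δₙ + κ/2`) satisfy `Fₙ(xₙ) → f(u)`, `f` the
harmonic function on `Ω` with boundary values `(2π)⁻¹ log ‖· − v‖`, namely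
`f = (2π)⁻¹ log ‖(φ⁻¹ · − conj φ⁻¹v)/dslope φ⁻¹ v ·‖`. Proof: compactness (`Fₙ` is lattice
harmonic on all of `Aₙ` and uniformly bounded), harmonicity of subsequential limits, boundary values
by the weak Beurling estimate, identification by the maximum principle.
[cite: ChelkakSmirnov2011, §3.2–3.3 (proofs of Thm. 3.8 and Thm. 3.10)] -/
theorem exists_subseq_tendsto_greenNormalised (hΩ : IsOpen Ω) (hΩR : Ω ⊆ ball (0 : ℂ) R)
    (φ : ConformalEquiv upperHalfPlaneSet Ω)
    (hδ : ∀ n, 0 < δ n) (hδ0 : Tendsto δ atTop (𝓝 0))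
    (hhole : ∀ n, HoleFree (↑(A n) : Set (Site 2)))
    (hAR : ∀ n, δ n • ChelkakSmirnov.starDomain (↑(A n) : Set (Site 2)) ⊆ ball (0 : ℂ) R)
    (hin : ∀ z ∈ Ω, ∃ ρ : ℝ, 0 < ρ ∧ ∀ᶠ n in atTop,
      ball z ρ ⊆ δ n • ChelkakSmirnov.starDomain (↑(A n) : Set (Site 2)))
    (hbd : ∀ a ∈ frontier Ω, ∀ ρ : ℝ, 0 < ρ → ∀ᶠ n in atTop,
      (frontier (δ n • ChelkakSmirnov.starDomain (↑(A n) : Set (Site 2))) ∩ ball a ρ).Nonempty)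
    (hu : u ∈ Ω) (hv : v ∈ Ω)
    (hxu : Tendsto (fun n => meshPoint (δ n) (x n)) atTop (𝓝 u))
    (hcv : Tendsto (fun n => meshPoint (δ n) (c n)) atTop (𝓝 v))
    (hA : Tendsto (fun y : Site 2 => latticePotentialKernel 2 y -
      (2 * π)⁻¹ * Real.log (((y 0 : ℤ) : ℝ) ^ 2 + ((y 1 : ℤ) : ℝ) ^ 2)) cofinite (𝓝 κ)) :
    ∃ ms : ℕ → ℕ, StrictMono ms ∧
      Tendsto (fun n => dirichletGreen (A (ms n)) (c (ms n)) (x (ms n)) +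
          latticePotentialKernel 2 (x (ms n) - c (ms n)) / 2 - (-(2 * π)⁻¹ * Real.log (δ (ms n)) + κ / 2))
        atTop (𝓝 ((2 * π)⁻¹ *
          Real.log ‖(φ.symm u - (starRingEnd ℂ) (φ.symm v)) / dslope φ.symm v u‖)) := by
  -- notation
  set F : ℕ → Site 2 → ℝ := fun n y => dirichletGreen (A n) (c n) y +
      latticePotentialKernel 2 (y - c n) / 2 - (-(2 * π)⁻¹ * Real.log (δ n) + κ / 2) with hF
  set f : ℂ → ℝ := fun z => (2 * π)⁻¹ *
      Real.log ‖(φ.symm z - (starRingEnd ℂ) (φ.symm v)) / dslope φ.symm v z‖ with hf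
  set Φ : ℂ → ℝ := fun z => (2 * π)⁻¹ * Real.log ‖z - v‖ with hΦ
  have hFharm : ∀ n, IsLatticeHarmonicOn (F n) ↑(A n) := fun n =>
    isLatticeHarmonicOn_greenNormalised (A n) (c n) _
  -- lattice consequences of kernel convergence
  have hin' : ∀ K ⊆ Ω, IsCompact K → ∀ᶠ n in atTop, ∀ y : Site 2, meshPoint (δ n) y ∈ K → y ∈ A n :=
    fun K hK hKc => eventually_forall_mem_of_meshPoint_mem hδ hin hK hKc
  have hout : ∀ a ∈ frontier Ω, ∀ ρ : ℝ, 0 < ρ → ∀ᶠ n in atTop,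
      ∃ p : Site 2, p ∉ A n ∧ dist (meshPoint (δ n) p) a < ρ :=
    fun a ha ρ hρ => eventually_exists_not_mem_near hδ hδ0 hbd ha hρ
  -- the sites outside `A n` stay away from the pole; the boundary sites stay in a bounded region
  obtain ⟨ρv, hρv, hρvin⟩ := hin v hv
  have hfar : ∀ᶠ n in atTop, ∀ w : Site 2, w ∉ A n → ρv ≤ dist (meshPoint (δ n) w) v := by
    filter_upwards [hρvin] with n hn w hw
    by_contra h
    exact hw ((meshPoint_mem_smul_starDomain_iff (hδ n)).1 (hn (mem_ball.2 (lt_of_not_ge h))))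
  have hvR : ‖v‖ < R := by simpa using hΩR hv
  have hnear : ∀ᶠ n in atTop, ∀ w ∈ latticeOuterBoundary (↑(A n) : Set (Site 2)),
      dist (meshPoint (δ n) w) v ≤ 2 * R + 1 := by
    filter_upwards [hδ0.eventually (Iio_mem_nhds one_pos)] with n hn w hw
    obtain ⟨y, hy, k, rfl⟩ := hw.2
    have hyR : ‖meshPoint (δ n) y‖ < R := by
      have := hAR n ((meshPoint_mem_smul_starDomain_iff (hδ n)).2 hy)
      simpa using this
    have h1 := dist_meshPoint_add_cornerUnit (hδ n) y k
    have hn' : δ n < 1 := hn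
    calc dist (meshPoint (δ n) (y + cornerUnit k)) v
        ≤ dist (meshPoint (δ n) (y + cornerUnit k)) (meshPoint (δ n) y) + dist (meshPoint (δ n) y) v :=
          dist_triangle _ _ _
      _ ≤ δ n + (‖meshPoint (δ n) y‖ + ‖v‖) := by rw [h1]; exact add_le_add le_rfl (dist_le_norm_add_norm _ _)
      _ ≤ 2 * R + 1 := by linarith
  set B : ℝ := (2 * π)⁻¹ * max |Real.log ρv| |Real.log (2 * R + 1)| + 1 with hB
  have hB0 : 0 ≤ B := by positivity
  have hbdF : ∀ᶠ n in atTop, ∀ y ∈ (↑(A n) : Set (Site 2)) ∪ latticeOuterBoundary (↑(A n) : Set (Site 2)),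
      |F n y| ≤ B := abs_greenNormalised_le hρv hδ hδ0 hfar hnear hcv hA
  have hdata : ∀ ε : ℝ, 0 < ε → ∀ᶠ n in atTop, ∀ w ∈ latticeOuterBoundary (↑(A n) : Set (Site 2)),
      |F n w - Φ (meshPoint (δ n) w)| ≤ ε :=
    fun ε hε => greenNormalised_data_of_far hρv hδ hδ0 hfar hcv hA hε
  -- compactness
  obtain ⟨φs, hφs, H, hHc, hunif⟩ := exists_subseq_tendstoUniformlyOn_of_eventually_latticeHarmonic hΩ hδ hδ0 F
    (fun K hK hKc => by
      filter_upwards [hin' K hK hKc] with n hn y hy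
      exact hFharm n y (Finset.mem_coe.2 (hn y (hy (mem_closedBall_self (hδ n).le)))))
    (fun K hK hKc => ⟨B, by
      filter_upwards [hin' K hK hKc, hbdF] with n hn hb y hy
      exact hb y (Or.inl (Finset.mem_coe.2 (hn y hy)))⟩)
  have hφt : Tendsto φs atTop atTop := hφs.tendsto_atTop
  -- pointwise convergence at points of `Ω`, read at the nearest sites
  have hptw : ∀ z ∈ Ω, Tendsto (fun n => F (φs n) (nearestSite (δ (φs n)) z)) atTop (𝓝 (H z)) := by
    intro z hz
    have h1 := (hunif {z} (singleton_subset_iff.2 hz) isCompact_singleton).tendsto_at (mem_singleton z)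
    exact h1
  -- `H` is harmonic on `Ω`
  have hHharm : HarmonicOnNhd H Ω := by
    intro z₀ hz₀
    obtain ⟨R₀, hR₀, hR₀Ω⟩ := Metric.isOpen_iff.1 hΩ z₀ hz₀
    have hcb : closedBall z₀ (R₀ / 2) ⊆ Ω := (closedBall_subset_ball (half_lt_self hR₀)).trans hR₀Ω
    obtain ⟨N, hN⟩ := eventually_atTop.1 (hφt.eventually (hin' _ hcb (isCompact_closedBall _ _)))
    have hδ' : ∀ k, 0 < δ (φs (k + N)) := fun k => hδ _
    have hδ0' : Tendsto (fun k => δ (φs (k + N))) atTop (𝓝 0) :=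
      (hδ0.comp hφt).comp (tendsto_add_atTop_nat N)
    have hharm' : ∀ k (y : Site 2), meshPoint (δ (φs (k + N))) y ∈ ball z₀ (R₀ / 2) →
        latticeLaplacian (F (φs (k + N))) y = 0 := fun k y hy =>
      hFharm _ y (Finset.mem_coe.2 (hN (k + N) (Nat.le_add_left N k) y (ball_subset_closedBall hy)))
    have hconv' : ∀ ε > 0, ∀ᶠ k in atTop, ∀ y : Site 2, meshPoint (δ (φs (k + N))) y ∈ closedBall z₀ (R₀ / 2) →
        |F (φs (k + N)) y - H (meshPoint (δ (φs (k + N))) y)| ≤ ε := by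
      intro ε hε
      have h1 := Metric.tendstoUniformlyOn_iff.1 (hunif _ hcb (isCompact_closedBall _ _)) ε hε
      have h2 := (tendsto_add_atTop_nat N).eventually h1
      filter_upwards [h2] with k hk y hy
      have := hk _ hy
      rw [nearestSite_meshPoint (hδ _).ne', Real.dist_eq, abs_sub_comm] at this
      exact this.le
    have hH' : ContinuousOn H (closedBall z₀ (R₀ / 2)) := hHc.mono hcb
    exact harmonicOnNhd_of_latticeHarmonic_limit (half_pos hR₀) hH' hδ' hδ0' hharm' hconv' z₀
      (mem_ball_self (half_pos hR₀))
  -- boundary values of `H`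
  have hHb : ∀ a ∈ frontier Ω, ∀ ε : ℝ, 0 < ε → ∀ᶠ z in 𝓝[Ω] a, |H z - Φ a| ≤ ε := by
    intro a ha ε hε
    have hav : a ≠ v := fun h => not_mem_of_mem_frontier_of_isOpen hΩ ha (h ▸ hv)
    obtain ⟨r, hr, hev⟩ := eventually_abs_sub_le_near_of_holeFree (V := fun n => A (φs n))
      (F := fun n => F (φs n)) (fun n => hδ (φs n)) (hδ0.comp hφt) (fun n => hhole (φs n))
      (fun n => hFharm (φs n)) hB0 (hφt.eventually hbdF) (continuousAt_logPotential (u := v) hav)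
      (fun ε' hε' => hφt.eventually (hdata ε' hε')) (fun ρ hρ => hφt.eventually (hout a ha ρ hρ)) hε
    have hmem : Ω ∩ ball a (r / 2) ∈ 𝓝[Ω] a := inter_mem_nhdsWithin Ω (ball_mem_nhds a (half_pos hr))
    filter_upwards [hmem] with z hz
    obtain ⟨hzΩ, hza⟩ := hz
    obtain ⟨ρz, hρz, hρzin⟩ := hin z hzΩ
    -- eventually the nearest site is in the domain and near `a`
    have hev2 : ∀ᶠ n in atTop, |F (φs n) (nearestSite (δ (φs n)) z) - Φ a| ≤ ε := by
      have hδφ : Tendsto (fun n => δ (φs n)) atTop (𝓝 0) := hδ0.comp hφt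
      filter_upwards [hev, hφt.eventually hρzin, hδφ.eventually (Iio_mem_nhds hρz),
        hδφ.eventually (Iio_mem_nhds (half_pos hr))] with n hn hin₂ hδρ hδr
      have hd := dist_meshPoint_nearestSite_le (hδ (φs n)) z
      have hδρ' : δ (φs n) < ρz := hδρ
      have hδr' : δ (φs n) < r / 2 := hδr
      refine hn _ ?_ ?_
      · exact (meshPoint_mem_smul_starDomain_iff (hδ (φs n))).1 (hin₂ (mem_ball.2 (hd.trans_lt hδρ')))
      · calc dist (meshPoint (δ (φs n)) (nearestSite (δ (φs n)) z)) a
            ≤ dist (meshPoint (δ (φs n)) (nearestSite (δ (φs n)) z)) z + dist z a := dist_triangle _ _ _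
          _ < r / 2 + r / 2 := add_lt_add (hd.trans_lt hδr') (mem_ball.1 hza)
          _ = r := by ring
    have hlim : Tendsto (fun n => |F (φs n) (nearestSite (δ (φs n)) z) - Φ a|) atTop (𝓝 |H z - Φ a|) :=
      ((hptw z hzΩ).sub_const _).abs
    exact le_of_tendsto hlim hev2
  -- the candidate `f` (the Green potential of `GreenPotentialBoundary.lean`) and its boundary values
  have hψd : DifferentiableOn ℂ (φ.symm : ℂ → ℂ) Ω := φ.symm.differentiableOn_coe
  have hbij : BijOn (φ.symm : ℂ → ℂ) Ω {z : ℂ | 0 < z.im} := φ.symm.bijOn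
  have hfharm : HarmonicOnNhd f Ω := harmonicOnNhd_greenPotential hΩ hψd hbij hv
  have hfb : ∀ a ∈ frontier Ω, ∀ ε : ℝ, 0 < ε → ∀ᶠ z in 𝓝[Ω] a, |f z - Φ a| ≤ ε := by
    intro a ha ε hε
    have haΩ : a ∉ Ω := not_mem_of_mem_frontier_of_isOpen hΩ ha
    have hav : a ≠ v := fun h => haΩ (h ▸ hv)
    have hΦc := continuousAt_logPotential (u := v) hav
    have h1 : ∀ᶠ z in 𝓝[Ω] a, |Φ z - Φ a| ≤ ε / 2 := by
      have := Metric.tendsto_nhds.1 (hΦc.tendsto) (ε / 2) (half_pos hε)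
      refine mem_nhdsWithin_of_mem_nhds (this.mono fun z hz => ?_)
      rw [Real.dist_eq] at hz; exact hz.le
    have h2 : ∀ᶠ z in 𝓝[Ω] a, z ≠ v :=
      mem_nhdsWithin_of_mem_nhds (isOpen_ne.mem_nhds hav)
    have h3 := Metric.tendsto_nhds.1 (tendsto_green_nhdsWithin_frontier hΩ hψd hbij hv haΩ) (ε / 2)
      (half_pos hε)
    filter_upwards [h1, h2, h3, self_mem_nhdsWithin] with z hz1 hz2 hz3 hzΩ
    have heq : f z - Φ z =
        (2 * π)⁻¹ * Real.log (‖φ.symm z - (starRingEnd ℂ) (φ.symm v)‖ / ‖φ.symm z - φ.symm v‖) := by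
      rw [hf, hΦ]; simp only
      rw [greenPotential_eq hbij hv hzΩ hz2]; ring
    have h4 : |f z - Φ z| ≤ ε / 2 := by
      rw [heq]
      rw [Real.dist_eq, sub_zero] at hz3
      exact hz3.le
    calc |f z - Φ a| = |(f z - Φ z) + (Φ z - Φ a)| := by ring_nf
      _ ≤ |f z - Φ z| + |Φ z - Φ a| := abs_add_le _ _
      _ ≤ ε / 2 + ε / 2 := add_le_add h4 hz1
      _ = ε := by ring
  -- identification
  have hΩc : IsPreconnected Ω := by
    have h1 := (convex_halfSpace_im_gt (0 : ℝ)).isPreconnected.image (φ : ℂ → ℂ) φ.continuousOn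
    rwa [φ.bijOn.image_eq] at h1
  have hHf : EqOn H f Ω := eqOn_of_harmonic_of_boundary hΩ hΩc hΩR hHharm hfharm hHb hfb
  -- convergence at the moving site
  refine ⟨φs, hφs, ?_⟩
  obtain ⟨ru, hru, hruΩ⟩ := Metric.isOpen_iff.1 hΩ u hu
  have hcbu : closedBall u (ru / 2) ⊆ Ω := (closedBall_subset_ball (half_lt_self hru)).trans hruΩ
  have hxu' : Tendsto (fun n => meshPoint (δ (φs n)) (x (φs n))) atTop (𝓝 u) := hxu.comp hφt
  have hHu : Tendsto (fun n => H (meshPoint (δ (φs n)) (x (φs n)))) atTop (𝓝 (H u)) :=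
    ((hHc.continuousAt (hΩ.mem_nhds hu)).tendsto).comp hxu'
  rw [show (2 * π)⁻¹ * Real.log ‖(φ.symm u - (starRingEnd ℂ) (φ.symm v)) / dslope φ.symm v u‖ = H u from
    (hHf hu).symm]
  rw [Metric.tendsto_nhds]
  intro ε hε
  have h1 := Metric.tendstoUniformlyOn_iff.1 (hunif _ hcbu (isCompact_closedBall _ _)) (ε / 2) (half_pos hε)
  have h2 := Metric.tendsto_nhds.1 hHu (ε / 2) (half_pos hε)
  have h3 : ∀ᶠ n in atTop, meshPoint (δ (φs n)) (x (φs n)) ∈ closedBall u (ru / 2) :=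
    hxu' (closedBall_mem_nhds u (half_pos hru))
  filter_upwards [h1, h2, h3] with n hn1 hn2 hn3
  have h4 := hn1 _ hn3
  rw [nearestSite_meshPoint (hδ _).ne'] at h4
  calc dist (F (φs n) (x (φs n))) (H u)
      ≤ dist (F (φs n) (x (φs n))) (H (meshPoint (δ (φs n)) (x (φs n)))) +
        dist (H (meshPoint (δ (φs n)) (x (φs n)))) (H u) := dist_triangle _ _ _
    _ < ε / 2 + ε / 2 := add_lt_add (by rw [dist_comm]; exact h4) hn2
    _ = ε := by ring

end Assembly


/-! ### H. The theorem -/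

section Main

open UpperHalfPlane (upperHalfPlaneSet)

/-- **Chelkak–Wan 2021, Corollary 3.3 / Chelkak–Smirnov 2011, Theorem 3.9 with Theorem 2.5, on
`ℤ²` — proved.** Under kernel (Carathéodory) convergence of the polygonal representations of
simply connected discrete domains `A_δ ⊆ ℤ²` to a bounded simply connected `Ω`, the Green's function
of simple random walk killed on leaving `A_δ` converges at interior points:
`Z_{Ω^δ}(u^δ, v^δ) → (2/π) G_ℍ(φ⁻¹u, φ⁻¹v)`. Discharges the named fact
`killedGreen_tendsto_of_kernelConvergence` (`DiscreteGreenKernelConvergence.lean`).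

Proof (the road of [CS11] §3, with the full-plane input of [CW21] Prop. 3.2 in the form of the
potential-kernel asymptotics `a(x) = (1/π) log|x| + κ + o(1)`, Lawler–Limic Thm. 4.4.4): along any
sequence of meshes, `G_{A}(c, ·) = ¼ Z(c, ·)` normalised by the potential kernel,
`F = G_A(c,·) + a(· − c)/2 − L`, is lattice harmonic on ALL of `A` with outer boundary values
`(2π)⁻¹ log ‖δw − v‖ + o(1)` and uniformly bounded (maximum principle); subsequential local uniform
limits exist (`exists_subseq_tendstoUniformlyOn_of_eventually_latticeHarmonic`), are harmonic
(`harmonicOnNhd_of_latticeHarmonic_limit`), take the boundary values `(2π)⁻¹ log ‖· − v‖` at every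
frontier point of `Ω` (two-constant bound and weak Beurling estimate from the exterior lattice
site supplied by kernel convergence, `eventually_abs_sub_le_near_of_holeFree`), hence all coincide
with `(2π)⁻¹ (log ‖z − v‖ + G_ℍ(φ⁻¹z, φ⁻¹v))` (maximum principle,
`eqOn_of_harmonic_of_boundary`); the sub-subsequence principle along `𝓝[>] 0` and
`a(u_δ − v_δ)/2 − L_δ → (2π)⁻¹ log ‖u − v‖` finish, with `Z = 4 G_A`.
[cite: ChelkakWan2021, Corollary 3.3 (§3.1); proof: ChelkakSmirnov2011 Thm. 3.9 + Thm. 2.5] -/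
theorem killedGreen_tendsto_of_kernelConvergence_holds : killedGreen_tendsto_of_kernelConvergence := by
  intro Ω R hΩ hΩR φ A hAev hK u v hu hv huv uδ vδ hmem hut hvt
  obtain ⟨κ, hA⟩ := latticePotentialKernel_two_asymptotics
  refine tendsto_of_subseq_tendsto fun ns hns => ?_
  -- along the sequence `ns`
  have hns0 : Tendsto ns atTop (𝓝 0) := tendsto_nhdsWithin_iff.1 hns |>.1
  have hnspos : ∀ᶠ k in atTop, 0 < ns k := tendsto_nhdsWithin_iff.1 hns |>.2
  obtain ⟨N, hN⟩ := eventually_atTop.1 (hnspos.and ((hns.eventually hAev).and (hns.eventually hmem)))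
  -- the shifted sequence
  set δ' : ℕ → ℝ := fun k => ns (k + N) with hδ'
  set A' : ℕ → Finset (Site 2) := fun k => A (ns (k + N)) with hA'
  set x : ℕ → Site 2 := fun k => uδ (ns (k + N)) with hx
  set c : ℕ → Site 2 := fun k => vδ (ns (k + N)) with hc
  have hshift : Tendsto (fun k => k + N) atTop atTop := tendsto_add_atTop_nat N
  have hns' : Tendsto δ' atTop (𝓝[>] 0) := hns.comp hshift
  have hδ'pos : ∀ k, 0 < δ' k := fun k => (hN (k + N) (Nat.le_add_left N k)).1
  have hδ'0 : Tendsto δ' atTop (𝓝 0) := hns0.comp hshift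
  have hdisc : ∀ k, ChelkakSmirnov.IsDiscreteDomain (A' k) := fun k => (hN (k + N) (Nat.le_add_left N k)).2.1.1
  have hA'R : ∀ k, δ' k • ChelkakSmirnov.starDomain (↑(A' k) : Set (Site 2)) ⊆ ball (0 : ℂ) R :=
    fun k => (hN (k + N) (Nat.le_add_left N k)).2.1.2
  have hxmem : ∀ k, x k ∈ A' k := fun k => (hN (k + N) (Nat.le_add_left N k)).2.2.1
  have hcmem : ∀ k, c k ∈ A' k := fun k => (hN (k + N) (Nat.le_add_left N k)).2.2.2
  have hin : ∀ z ∈ Ω, ∃ ρ : ℝ, 0 < ρ ∧ ∀ᶠ k in atTop,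
      ball z ρ ⊆ δ' k • ChelkakSmirnov.starDomain (↑(A' k) : Set (Site 2)) := by
    intro z hz
    obtain ⟨ρ, hρ, hev⟩ := hK.1 z hz
    exact ⟨ρ, hρ, hns'.eventually hev⟩
  have hbd : ∀ a ∈ frontier Ω, ∀ ρ : ℝ, 0 < ρ → ∀ᶠ k in atTop,
      (frontier (δ' k • ChelkakSmirnov.starDomain (↑(A' k) : Set (Site 2))) ∩ ball a ρ).Nonempty :=
    fun a ha ρ hρ => hns'.eventually (hK.2 a ha ρ hρ)
  have hxu : Tendsto (fun k => meshPoint (δ' k) (x k)) atTop (𝓝 u) := hut.comp (hns.comp hshift)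
  have hcv : Tendsto (fun k => meshPoint (δ' k) (c k)) atTop (𝓝 v) := hvt.comp (hns.comp hshift)
  -- the core theorem
  obtain ⟨ms, hms, hF⟩ := exists_subseq_tendsto_greenNormalised hΩ hΩR φ hδ'pos hδ'0
    (fun k => (hdisc k).2.2) hA'R hin hbd hu hv hxu hcv hA
  have hmst : Tendsto ms atTop atTop := hms.tendsto_atTop
  -- the potential-kernel part
  have hpot := tendsto_potentialNormalised (fun j => hδ'pos (ms j)) (hδ'0.comp hmst) (hxu.comp hmst)
    (hcv.comp hmst) huv hA
  -- assemble: `Z = 4 G = 4 (F - (a/2 - L))`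
  refine ⟨fun j => ms j + N, ?_⟩
  have hlim := (hF.sub hpot).const_mul 4
  have heq : ∀ j, SRW.killedGreen (ChordalLERW.siteGraph (↑(A (ns (ms j + N))) : Set (Site 2)))
      (uδ (ns (ms j + N))) (vδ (ns (ms j + N))) =
      4 * ((dirichletGreen (A' (ms j)) (c (ms j)) (x (ms j)) +
        latticePotentialKernel 2 (x (ms j) - c (ms j)) / 2 - (-(2 * π)⁻¹ * Real.log (δ' (ms j)) + κ / 2)) -
        (latticePotentialKernel 2 (x (ms j) - c (ms j)) / 2 - (-(2 * π)⁻¹ * Real.log (δ' (ms j)) + κ / 2))) := by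
    intro j
    rw [KozdronLawler.killedGreen_siteGraph_eq_four_mul_dirichletGreen _ (hcmem (ms j)), dirichletGreen_comm]
    ring
  simp_rw [heq]
  convert hlim using 2
  rw [Literature.Probability.RandomPlanarGeometry.greenPotential_eq (w := (φ.symm : ℂ → ℂ)) φ.symm.bijOn hv hu huv]
  ring


/-- **Corollary 3.3 with hole-freeness only.** The proof above uses, of the three clauses of
`ChelkakSmirnov.IsDiscreteDomain` (nonempty, connected skeleton, hole-free), only hole-freeness
(the weak Beurling estimate needs the exterior site to escape to infinity off the domain;
connectedness of the vertex set plays no role for the pointwise statement). We record the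
statement in this generality — the form consumed by inner/outer lattice sandwiches, whose
hole-free fills and free-site sets need not be connected at a fixed mesh. Same conclusion as
`killedGreen_tendsto_of_kernelConvergence` under `HoleFree ↑(A δ)` in place of
`IsDiscreteDomain (A δ)`. [cite: ChelkakWan2021, Corollary 3.3 (§3.1)] -/
theorem killedGreen_tendsto_of_holeFree_of_kernelConvergence
    (Ω : Set ℂ) (R : ℝ) (hΩ : IsOpen Ω) (hΩR : Ω ⊆ ball (0 : ℂ) R)
    (φ : ConformalEquiv upperHalfPlaneSet Ω) (A : ℝ → Finset (Site 2))
    (hAev : ∀ᶠ δ in 𝓝[>] (0 : ℝ), HoleFree (↑(A δ) : Set (Site 2)) ∧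
      δ • ChelkakSmirnov.starDomain (↑(A δ) : Set (Site 2)) ⊆ ball (0 : ℂ) R)
    (hK : ChelkakSmirnov.KernelConvergence
      (fun δ => δ • ChelkakSmirnov.starDomain (↑(A δ) : Set (Site 2))) Ω)
    (u v : ℂ) (hu : u ∈ Ω) (hv : v ∈ Ω) (huv : u ≠ v)
    (uδ vδ : ℝ → Site 2) (hmem : ∀ᶠ δ in 𝓝[>] (0 : ℝ), uδ δ ∈ A δ ∧ vδ δ ∈ A δ)
    (hut : Tendsto (fun δ : ℝ => (δ : ℂ) * Site.toComplex (uδ δ)) (𝓝[>] 0) (𝓝 u))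
    (hvt : Tendsto (fun δ : ℝ => (δ : ℂ) * Site.toComplex (vδ δ)) (𝓝[>] 0) (𝓝 v)) :
    Tendsto (fun δ : ℝ => SRW.killedGreen (ChordalLERW.siteGraph (↑(A δ) : Set (Site 2))) (uδ δ) (vδ δ))
      (𝓝[>] 0) (𝓝 (2 / Real.pi *
        Real.log (‖φ.symm u - (starRingEnd ℂ) (φ.symm v)‖ / ‖φ.symm u - φ.symm v‖))) := by
  obtain ⟨κ, hA⟩ := latticePotentialKernel_two_asymptotics
  refine tendsto_of_subseq_tendsto fun ns hns => ?_
  have hns0 : Tendsto ns atTop (𝓝 0) := tendsto_nhdsWithin_iff.1 hns |>.1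
  have hnspos : ∀ᶠ k in atTop, 0 < ns k := tendsto_nhdsWithin_iff.1 hns |>.2
  obtain ⟨N, hN⟩ := eventually_atTop.1 (hnspos.and ((hns.eventually hAev).and (hns.eventually hmem)))
  set δ' : ℕ → ℝ := fun k => ns (k + N) with hδ'
  set A' : ℕ → Finset (Site 2) := fun k => A (ns (k + N)) with hA'
  set x : ℕ → Site 2 := fun k => uδ (ns (k + N)) with hx
  set c : ℕ → Site 2 := fun k => vδ (ns (k + N)) with hc
  have hshift : Tendsto (fun k => k + N) atTop atTop := tendsto_add_atTop_nat N
  have hns' : Tendsto δ' atTop (𝓝[>] 0) := hns.comp hshift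
  have hδ'pos : ∀ k, 0 < δ' k := fun k => (hN (k + N) (Nat.le_add_left N k)).1
  have hδ'0 : Tendsto δ' atTop (𝓝 0) := hns0.comp hshift
  have hhole : ∀ k, HoleFree (↑(A' k) : Set (Site 2)) := fun k => (hN (k + N) (Nat.le_add_left N k)).2.1.1
  have hA'R : ∀ k, δ' k • ChelkakSmirnov.starDomain (↑(A' k) : Set (Site 2)) ⊆ ball (0 : ℂ) R :=
    fun k => (hN (k + N) (Nat.le_add_left N k)).2.1.2
  have hcmem : ∀ k, c k ∈ A' k := fun k => (hN (k + N) (Nat.le_add_left N k)).2.2.2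
  have hin : ∀ z ∈ Ω, ∃ ρ : ℝ, 0 < ρ ∧ ∀ᶠ k in atTop,
      ball z ρ ⊆ δ' k • ChelkakSmirnov.starDomain (↑(A' k) : Set (Site 2)) := by
    intro z hz
    obtain ⟨ρ, hρ, hev⟩ := hK.1 z hz
    exact ⟨ρ, hρ, hns'.eventually hev⟩
  have hbd : ∀ a ∈ frontier Ω, ∀ ρ : ℝ, 0 < ρ → ∀ᶠ k in atTop,
      (frontier (δ' k • ChelkakSmirnov.starDomain (↑(A' k) : Set (Site 2))) ∩ ball a ρ).Nonempty :=
    fun a ha ρ hρ => hns'.eventually (hK.2 a ha ρ hρ)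
  have hxu : Tendsto (fun k => meshPoint (δ' k) (x k)) atTop (𝓝 u) := hut.comp (hns.comp hshift)
  have hcv : Tendsto (fun k => meshPoint (δ' k) (c k)) atTop (𝓝 v) := hvt.comp (hns.comp hshift)
  obtain ⟨ms, hms, hF⟩ := exists_subseq_tendsto_greenNormalised hΩ hΩR φ hδ'pos hδ'0
    hhole hA'R hin hbd hu hv hxu hcv hA
  have hmst : Tendsto ms atTop atTop := hms.tendsto_atTop
  have hpot := tendsto_potentialNormalised (fun j => hδ'pos (ms j)) (hδ'0.comp hmst) (hxu.comp hmst)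
    (hcv.comp hmst) huv hA
  refine ⟨fun j => ms j + N, ?_⟩
  have hlim := (hF.sub hpot).const_mul 4
  have heq : ∀ j, SRW.killedGreen (ChordalLERW.siteGraph (↑(A (ns (ms j + N))) : Set (Site 2)))
      (uδ (ns (ms j + N))) (vδ (ns (ms j + N))) =
      4 * ((dirichletGreen (A' (ms j)) (c (ms j)) (x (ms j)) +
        latticePotentialKernel 2 (x (ms j) - c (ms j)) / 2 - (-(2 * π)⁻¹ * Real.log (δ' (ms j)) + κ / 2)) -
        (latticePotentialKernel 2 (x (ms j) - c (ms j)) / 2 - (-(2 * π)⁻¹ * Real.log (δ' (ms j)) + κ / 2))) := by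
    intro j
    rw [KozdronLawler.killedGreen_siteGraph_eq_four_mul_dirichletGreen _ (hcmem (ms j)), dirichletGreen_comm]
    ring
  simp_rw [heq]
  convert hlim using 2
  rw [Literature.Probability.RandomPlanarGeometry.greenPotential_eq (w := (φ.symm : ℂ → ℂ)) φ.symm.bijOn hv hu huv]
  ring

end Main

end Literature.Probability.LatticeModels
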